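import Summits.ABC.IUTFork.Joshi.ATS4RamificationTateDivisor
import Summits.ABC.IUTFork.Joshi.ATS4LocusUpperBounds
import Summits.ABC.IUTFork.Joshi.ATS4SecondMainBound
import HarnessLib

/-!
# Joshi, *Arithmetic Teichmüller Spaces IV* (arXiv:2403.10430v2) (6.11.7): the identity «|log(q_ℓ)| = (1/2ℓ)·log(q)»
# DERIVED for genuine Tate parameters — and WHICH normalisation of `|·|_{L′_w}` it pins (proof-only supplier file)

Proof-only companion file of the abc-iut cell, branch E «type Joshi's construction, test vs S» (rung LADDER-ABC:A2.E;
seat abc-iut-E-t54 = the «[J-IV] DERIVABLE seat» of plan/E/ASSIGNMENTS (E-plan-2 07:46:39Z); the row is E-t26's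
DERIVABLE hint 07:36:56Z on p430311). **No side is taken** on [IUTchIII] Cor. 3.12 / [IUTchIV] Thm. 1.10, on Joshi's
claims (unrefereed arXiv preprint, «Preliminary version for comments») or on Mochizuki's report on them; typed ≠ proved ≠
endorsed. Nothing here is a new definition or a new `Prop` fact: the file imports three landed Joshi object files BY NAME
(E-t26 `ATS4RamificationTateDivisor` p430057, E-t31 `ATS4LocusUpperBounds` p430311, E-t4 `ATS4SecondMainBound` p428915)
and proves theorems about them (DEFS-FREEZE respected; plan/E/E-PLAN.md R14: no `Cor312*`/`Thm311*` import).
Locators «p.N l.M» = line M of page file `pNNNN.txt` of the cell's render `HOME/lit/renders/Joshi-arxiv-2403.10430/` (v2).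

## The printed sentences

* [J-IV] (6.11.7) (p.71 l.95–100): «|log(q_ℓ)| := Σ_{p, w ∈ 𝕍^{odd,ss}_p ≠ ∅} log|q_w^{1/2ℓ}|_{L′_w} … is precisely the
  quantity which appears in … the right hand side of the fundamental estimate»; p.71 l.104–106: «(1/2ℓ)·log(q) =
  |log(q_ℓ)|» — typed by E-t31 as the READING PREDICATE `LocusVolumeDatum.LogqDictionary` («1/(2ℓ)·log(q) =
  |log(q_ℓ)|», p430311) and consumed by `cTheta_mul_eq` / the UPPER bound of Thm 6.10.1; E-t4's (6.11.7) sum is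
  `ATS3.AdelicLocusDatum.absLogQl A = Σ_w |log (A.loc w).qroot|` (p428915) with `qroot = |q_w^{1/2ℓ}|`.
* [J-IV] (4.4.5) (p.41 l.22–29): «log(𝔮_M) = (1/[M:ℚ])·Σ_{w ∈ V^{odd,ss}_M} ord_w(q_w)·log w» — E-t26's
  `TateDivisorDatum.logq_eq_sum` (PROVED, p430057) over the GENUINE number field `M` (Mathlib `NumberField`).
* [J-IV] Thm 6.10.1 (p.66 l.9–12): «Choose the same global normalization for the number field provided by the
  arithmeticoids y′₀ and y₀»; [J-III] (2401.13508v4) Thm 7.3.1 normalisation «|π_w| = p_w^{−1}» (E-t4's docstring of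
  `LocusDatum.qroot`: «`|q_w^{1/2ℓ}|_{C_{p_w}}`»).

## What the kernel DERIVES here (E-t26's hint, verbatim aim: «LogqDictionary … becomes a THEOREM once q_w are elements and
|·|_{L′_w} is the Arakelov-normalised absolute value»)

For a genuine number field `M`, a `TateDivisorDatum 𝔮` and ELEMENTS `q_w ∈ M` (`w ∈ V^{odd,ss}_M`) with `ord_w(q_w) =
ordq w` (so `q_w ≠ 0`, `ord_w(q_w) ≥ 1`), writing `‖·‖_w` for Mathlib's `NumberField.HeightOneSpectrum.adicAbv M w`
(`‖x‖_w = |κ(w)|^{−ord_w(x)}`, tree `Literature.IUT.LogVolume.adicAbv_eq_absNorm_zpow`):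
1. `log‖q_w‖_w = −ord_w(q_w)·log|κ(w)|` (tree conversion formula `log_adicAbv_eq_neg_deg`, Dupuy–Hilado (2.5.5)) and
   `(1/[M:ℚ])·Σ_w (−log‖q_w‖_w) = log(𝔮_M)` (`neg_sum_log_adicAbv_div_finrank_eq_logq`).
2. **GLOBAL normalisation** `|x|_w := ‖x‖_w^{1/[M:ℚ]}`: `Σ_w |log(|q_w|_w^{1/2ℓ})| = (1/2ℓ)·log(𝔮_M)` ON THE NOSE
   (`sum_abs_log_globalRoot_eq`) — so E-t31's `LogqDictionary` HOLDS at every `LocusVolumeDatum` whose `absLogThetaQ` is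
   this sum (`logqDictionary_of_global`), and E-t4's `absLogQl = (1/2ℓ)·log(𝔮)` whenever `(A.loc w).qroot` is the
   globally-normalised root (`absLogQl_eq_of_global`).
3. **LOCAL normalisation** `|x|_{w,p} := ‖x‖_w^{1/n_w}`, `n_w = e_w·f_w = [M_w:ℚ_p]` (= the `|·|_{C_{p_w}}` of [J-III]
   Thm 7.3.1, `|p_w| = p_w^{−1}`): `Σ_w |log(|q_w|_{w,p}^{1/2ℓ})| = (1/2ℓ)·Σ_w ord_w(q_w)·log|κ(w)|/n_w ≥ (1/2ℓ)·log(𝔮_M)`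
   (`sum_abs_log_localRoot_eq`, `logq_le_sum_abs_log_localRoot`), with equality iff `n_w = [M:ℚ]` at every
   `w ∈ V^{odd,ss}_M` (`sum_abs_log_localRoot_eq_iff`) — e.g. always for `M = ℚ`, never when some `w ∈ V^{odd,ss}` has
   `[M_w:ℚ_{p_w}] < [M:ℚ]`.

LOCATED (dictionary row, no adjudication): [J-IV]'s «(1/2ℓ)·log(q) = |log(q_ℓ)|» (p.71 l.104–106) is a THEOREM for the
`÷[L′:ℚ]`-normalised absolute values («same global normalization», p.66 l.9–12) and is an INEQUALITY `≥` (generically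
strict) for the `|·|_{C_p}`-normalised roots `|q_w^{1/2ℓ}|_{C_{p_w}}` of [J-III] Thm 7.3.1 / E-t4's `LocusDatum.qroot`; since
E-t31 derives the UPPER bound of Thm 6.10.1 from (6.11.6) through the EQUALITY (`cTheta_mul_eq`), the (6.11.7) sum entering
`C_Θ·|log(q_ℓ)|` must be read with the global weights `n_w/[L′:ℚ]` on the `|·|_{C_p}`-logs (equivalently with `|·|_w :=
‖·‖_w^{1/[L′:ℚ]}`). A property of the typed bookkeeping; typed ≠ proved; no claim about any author's intent.

[claim: Joshi2024ATS4, status: disputed] (locators only); the theorems are [folklore] (valuation bookkeeping on Mathlib's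
`adicAbv` and the tree's Arakelov-degree files, cited BY NAME: `Literature.IUT.LogVolume.log_adicAbv_eq_neg_deg`,
`FinDivisor.deg_of`, `logNorm_pos`, `localDegree_pos`, `sum_localDegree`, `mem_placesOver_residueChar`). Standard axioms only.
-/

noncomputable section

open Finset
open NumberField IsDedekindDomain
open Literature.IUT.LogVolume

namespace Summit.ABC.IUTFork.Joshi.ATS4

namespace TateDivisorDatum

variable {M : Type*} [Field M] [NumberField M] (𝔮 : TateDivisorDatum M)

/-! ## 1. The conversion formula at one place, and (4.4.5) read on elements -/

/-- `log‖x‖_w = −ord_w(x)·log|κ(w)|` for `x ≠ 0` (Dupuy–Hilado (2.5.5), tree `log_adicAbv_eq_neg_deg` + `FinDivisor.deg_of`).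
[folklore] -/
theorem log_adicAbv_eq_neg_ord_mul_logNorm (w : HeightOneSpectrum (𝓞 M)) {x : M} (hx : x ≠ 0) :
    Real.log (HeightOneSpectrum.adicAbv M w x) = -(ord M w x : ℝ) * logNorm M w := by
  rw [log_adicAbv_eq_neg_deg M w hx, FinDivisor.deg_of]
  ring

/-- A nonzero element has positive `w`-adic absolute value. [folklore] -/
theorem adicAbv_pos_of_ne_zero (w : HeightOneSpectrum (𝓞 M)) {x : M} (hx : x ≠ 0) :
    0 < HeightOneSpectrum.adicAbv M w x :=
  (HeightOneSpectrum.adicAbv M w).pos hx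

variable (q : HeightOneSpectrum (𝓞 M) → M)

/-! «ELEMENTS realising the Tate divisor datum»: the hypothesis `h : ∀ w ∈ 𝔮.V, ord M w (q w) = 𝔮.ordq w`
(Def. 4.4.2, p.40 l.48–p.41 l.1: `q_w` a Tate parameter of `C_{M_w}`, «well defined up to multiplication by a local unit» —
only its order enters) is carried INLINE by every theorem below (no new definition; a hypothesis on the pair `(𝔮, q)`,
not a claim). -/

variable {𝔮 q}

/-- A realising element is nonzero (its order is `≥ 1`, while `ord_w(0) = 0` is the tree's junk value). [folklore] -/
theorem ne_zero_of_realises (h : ∀ w ∈ 𝔮.V, ord M w (q w) = 𝔮.ordq w) {w : HeightOneSpectrum (𝓞 M)} (hw : w ∈ 𝔮.V) : q w ≠ 0 := by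
  intro h0
  have h1 := h w hw
  rw [h0, ord_zero] at h1
  have h2 := 𝔮.ordq_pos w hw
  omega

/-- For realising elements: `log‖q_w‖_w = −ordq(w)·log|κ(w)| < 0`. [folklore] -/
theorem log_adicAbv_eq_of_realises (h : ∀ w ∈ 𝔮.V, ord M w (q w) = 𝔮.ordq w) {w : HeightOneSpectrum (𝓞 M)} (hw : w ∈ 𝔮.V) :
    Real.log (HeightOneSpectrum.adicAbv M w (q w)) = -(𝔮.ordq w : ℝ) * logNorm M w := by
  rw [log_adicAbv_eq_neg_ord_mul_logNorm w (ne_zero_of_realises h hw), h w hw]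
  push_cast
  ring

/-- For realising elements: `log‖q_w‖_w < 0` (`ordq(w) ≥ 1`, `log|κ(w)| > 0`). [folklore] -/
theorem log_adicAbv_neg_of_realises (h : ∀ w ∈ 𝔮.V, ord M w (q w) = 𝔮.ordq w) {w : HeightOneSpectrum (𝓞 M)} (hw : w ∈ 𝔮.V) :
    Real.log (HeightOneSpectrum.adicAbv M w (q w)) < 0 := by
  rw [log_adicAbv_eq_of_realises h hw]
  have h1 : (1 : ℝ) ≤ 𝔮.ordq w := by exact_mod_cast 𝔮.ordq_pos w hw
  have h2 := logNorm_pos M w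
  nlinarith

/-- **(4.4.5) on elements**: `(1/[M:ℚ])·Σ_{w ∈ V^{odd,ss}_M} (−log‖q_w‖_w) = log(𝔮_M)` (E-t26's `logq_eq_sum` + the
conversion formula). [folklore] -/
theorem neg_sum_log_adicAbv_div_finrank_eq_logq (h : ∀ w ∈ 𝔮.V, ord M w (q w) = 𝔮.ordq w) :
    (∑ w ∈ 𝔮.V, -Real.log (HeightOneSpectrum.adicAbv M w (q w))) / Module.finrank ℚ M = 𝔮.logq := by
  rw [𝔮.logq_eq_sum]
  congr 1
  refine Finset.sum_congr rfl fun w hw => ?_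
  rw [log_adicAbv_eq_of_realises h hw]
  ring

/-! ## 2. GLOBAL normalisation `|x|_w := ‖x‖_w^{1/[M:ℚ]}`: (6.11.7) «|log(q_ℓ)| = (1/2ℓ)·log(q)» ON THE NOSE -/

/-- `[M:ℚ] > 0` as a real number. [folklore] -/
theorem finrank_real_pos : (0 : ℝ) < Module.finrank ℚ M := by exact_mod_cast Module.finrank_pos

/-- The log of the globally-normalised `2ℓ`-th root: `log((‖q_w‖_w^{1/[M:ℚ]})^{1/2ℓ}) = (1/2ℓ)·(1/[M:ℚ])·log‖q_w‖_w`.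
[folklore] -/
theorem log_globalRoot (h : ∀ w ∈ 𝔮.V, ord M w (q w) = 𝔮.ordq w) {w : HeightOneSpectrum (𝓞 M)} (hw : w ∈ 𝔮.V) (ℓ : ℕ) :
    Real.log (((HeightOneSpectrum.adicAbv M w (q w)) ^ ((Module.finrank ℚ M : ℝ)⁻¹)) ^ ((2 * ℓ : ℝ)⁻¹)) =
      (2 * ℓ : ℝ)⁻¹ * ((Module.finrank ℚ M : ℝ)⁻¹ * Real.log (HeightOneSpectrum.adicAbv M w (q w))) := by
  have hpos := adicAbv_pos_of_ne_zero w (ne_zero_of_realises h hw)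
  rw [Real.log_rpow (Real.rpow_pos_of_pos hpos _), Real.log_rpow hpos]

/-- **(6.11.7) = (1/2ℓ)·log(q) under the GLOBAL normalisation**: `Σ_{w ∈ V^{odd,ss}_M} |log((‖q_w‖_w^{1/[M:ℚ]})^{1/2ℓ})| =
(1/2ℓ)·log(𝔮_M)` for `ℓ ≥ 1`. [folklore] -/
theorem sum_abs_log_globalRoot_eq (h : ∀ w ∈ 𝔮.V, ord M w (q w) = 𝔮.ordq w) {ℓ : ℕ} (hℓ : 0 < ℓ) :
    ∑ w ∈ 𝔮.V, |Real.log (((HeightOneSpectrum.adicAbv M w (q w)) ^ ((Module.finrank ℚ M : ℝ)⁻¹)) ^ ((2 * ℓ : ℝ)⁻¹))| =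
      1 / (2 * ℓ) * 𝔮.logq := by
  have hℓ' : (0 : ℝ) < 2 * ℓ := by positivity
  have hd := finrank_real_pos (M := M)
  calc ∑ w ∈ 𝔮.V, |Real.log (((HeightOneSpectrum.adicAbv M w (q w)) ^ ((Module.finrank ℚ M : ℝ)⁻¹)) ^ ((2 * ℓ : ℝ)⁻¹))|
      = ∑ w ∈ 𝔮.V, (2 * ℓ : ℝ)⁻¹ * ((Module.finrank ℚ M : ℝ)⁻¹ *
          -Real.log (HeightOneSpectrum.adicAbv M w (q w))) := by
        refine Finset.sum_congr rfl fun w hw => ?_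
        rw [log_globalRoot h hw ℓ]
        have hneg := log_adicAbv_neg_of_realises h hw
        have : (2 * ℓ : ℝ)⁻¹ * ((Module.finrank ℚ M : ℝ)⁻¹ * Real.log (HeightOneSpectrum.adicAbv M w (q w))) < 0 :=
          mul_neg_of_pos_of_neg (inv_pos.mpr hℓ') (mul_neg_of_pos_of_neg (inv_pos.mpr hd) hneg)
        rw [abs_of_neg this]
        ring
    _ = (2 * ℓ : ℝ)⁻¹ * ((∑ w ∈ 𝔮.V, -Real.log (HeightOneSpectrum.adicAbv M w (q w))) / Module.finrank ℚ M) := by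
        rw [← Finset.mul_sum, ← Finset.mul_sum, div_eq_inv_mul]
    _ = 1 / (2 * ℓ) * 𝔮.logq := by rw [neg_sum_log_adicAbv_div_finrank_eq_logq h, one_div]

/-! ## 3. LOCAL normalisation `|x|_{w,p} := ‖x‖_w^{1/n_w}` (`n_w = [M_w:ℚ_p]`, i.e. `|p_w| = p_w^{−1}`): an INEQUALITY -/

/-- `n_w = e_w·f_w ≤ [M:ℚ]` (one term of the fundamental identity `Σ_{v | p_w} n_v = [M:ℚ]`, tree `sum_localDegree`).
[folklore] -/
theorem localDegree_le_finrank (w : HeightOneSpectrum (𝓞 M)) : localDegree M w ≤ Module.finrank ℚ M := by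
  haveI : Fact (residueChar M w).Prime := ⟨residueChar_prime M w⟩
  rw [← sum_localDegree M (residueChar M w)]
  exact Finset.single_le_sum (fun v _ => Nat.zero_le _) (mem_placesOver_residueChar (F := M) w)

/-- `n_w > 0` as a real number. [folklore] -/
theorem localDegree_real_pos (w : HeightOneSpectrum (𝓞 M)) : (0 : ℝ) < localDegree M w := by
  exact_mod_cast localDegree_pos M w

/-- The log of the locally-normalised `2ℓ`-th root: `log((‖q_w‖_w^{1/n_w})^{1/2ℓ}) = (1/2ℓ)·(1/n_w)·log‖q_w‖_w`. [folklore] -/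
theorem log_localRoot (h : ∀ w ∈ 𝔮.V, ord M w (q w) = 𝔮.ordq w) {w : HeightOneSpectrum (𝓞 M)} (hw : w ∈ 𝔮.V) (ℓ : ℕ) :
    Real.log (((HeightOneSpectrum.adicAbv M w (q w)) ^ ((localDegree M w : ℝ)⁻¹)) ^ ((2 * ℓ : ℝ)⁻¹)) =
      (2 * ℓ : ℝ)⁻¹ * ((localDegree M w : ℝ)⁻¹ * Real.log (HeightOneSpectrum.adicAbv M w (q w))) := by
  have hpos := adicAbv_pos_of_ne_zero w (ne_zero_of_realises h hw)
  rw [Real.log_rpow (Real.rpow_pos_of_pos hpos _), Real.log_rpow hpos]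

/-- **(6.11.7) under the LOCAL (`|·|_{C_p}`) normalisation, computed**: `Σ_{w ∈ V^{odd,ss}_M} |log((‖q_w‖_w^{1/n_w})^{1/2ℓ})| =
(1/2ℓ)·Σ_w ordq(w)·log|κ(w)|/n_w`. [folklore] -/
theorem sum_abs_log_localRoot_eq (h : ∀ w ∈ 𝔮.V, ord M w (q w) = 𝔮.ordq w) {ℓ : ℕ} (hℓ : 0 < ℓ) :
    ∑ w ∈ 𝔮.V, |Real.log (((HeightOneSpectrum.adicAbv M w (q w)) ^ ((localDegree M w : ℝ)⁻¹)) ^ ((2 * ℓ : ℝ)⁻¹))| =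
      1 / (2 * ℓ) * ∑ w ∈ 𝔮.V, (𝔮.ordq w : ℝ) * logNorm M w / localDegree M w := by
  have hℓ' : (0 : ℝ) < 2 * ℓ := by positivity
  rw [one_div, Finset.mul_sum]
  refine Finset.sum_congr rfl fun w hw => ?_
  rw [log_localRoot h hw ℓ]
  have hn := localDegree_real_pos (M := M) w
  have hneg := log_adicAbv_neg_of_realises h hw
  have : (2 * ℓ : ℝ)⁻¹ * ((localDegree M w : ℝ)⁻¹ * Real.log (HeightOneSpectrum.adicAbv M w (q w))) < 0 :=
    mul_neg_of_pos_of_neg (inv_pos.mpr hℓ') (mul_neg_of_pos_of_neg (inv_pos.mpr hn) hneg)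
  rw [abs_of_neg this, log_adicAbv_eq_of_realises h hw, div_eq_mul_inv]
  ring

/-- Termwise: `ordq(w)·log|κ(w)|/[M:ℚ] ≤ ordq(w)·log|κ(w)|/n_w` (as `n_w ≤ [M:ℚ]`). [folklore] -/
theorem term_global_le_local (w : HeightOneSpectrum (𝓞 M)) :
    (𝔮.ordq w : ℝ) * logNorm M w / Module.finrank ℚ M ≤ (𝔮.ordq w : ℝ) * logNorm M w / localDegree M w := by
  have hnum : 0 ≤ (𝔮.ordq w : ℝ) * logNorm M w := by
    have := logNorm_pos M w
    have : (0 : ℝ) ≤ 𝔮.ordq w := Nat.cast_nonneg _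
    positivity
  exact div_le_div_of_nonneg_left hnum (localDegree_real_pos w) (by exact_mod_cast localDegree_le_finrank w)

/-- **The LOCAL-normalised (6.11.7) sum dominates `(1/2ℓ)·log(q)`**: `(1/2ℓ)·log(𝔮_M) ≤ Σ_w |log((‖q_w‖_w^{1/n_w})^{1/2ℓ})|`.
[folklore] -/
theorem logq_le_sum_abs_log_localRoot (h : ∀ w ∈ 𝔮.V, ord M w (q w) = 𝔮.ordq w) {ℓ : ℕ} (hℓ : 0 < ℓ) :
    1 / (2 * ℓ) * 𝔮.logq ≤
      ∑ w ∈ 𝔮.V, |Real.log (((HeightOneSpectrum.adicAbv M w (q w)) ^ ((localDegree M w : ℝ)⁻¹)) ^ ((2 * ℓ : ℝ)⁻¹))| := by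
  rw [sum_abs_log_localRoot_eq h hℓ, 𝔮.logq_eq_sum, Finset.sum_div]
  have hℓ' : (0 : ℝ) ≤ 1 / (2 * ℓ) := by positivity
  exact mul_le_mul_of_nonneg_left (Finset.sum_le_sum fun w _ => 𝔮.term_global_le_local w) hℓ'

/-- **… with equality iff every `w ∈ V^{odd,ss}_M` has full local degree `n_w = [M:ℚ]`** (each term `ordq(w)·log|κ(w)| > 0`).
[folklore] -/
theorem sum_abs_log_localRoot_eq_iff (h : ∀ w ∈ 𝔮.V, ord M w (q w) = 𝔮.ordq w) {ℓ : ℕ} (hℓ : 0 < ℓ) :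
    ∑ w ∈ 𝔮.V, |Real.log (((HeightOneSpectrum.adicAbv M w (q w)) ^ ((localDegree M w : ℝ)⁻¹)) ^ ((2 * ℓ : ℝ)⁻¹))| =
        1 / (2 * ℓ) * 𝔮.logq ↔
      ∀ w ∈ 𝔮.V, localDegree M w = Module.finrank ℚ M := by
  have hℓ' : (0 : ℝ) < 1 / (2 * ℓ) := by positivity
  rw [sum_abs_log_localRoot_eq h hℓ, 𝔮.logq_eq_sum, Finset.sum_div]
  constructor
  · intro heq w hw
    have hsum : ∑ v ∈ 𝔮.V, (𝔮.ordq v : ℝ) * logNorm M v / localDegree M v =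
        ∑ v ∈ 𝔮.V, (𝔮.ordq v : ℝ) * logNorm M v / Module.finrank ℚ M :=
      mul_left_cancel₀ hℓ'.ne' heq
    have hterm := (Finset.sum_eq_sum_iff_of_le fun v _ => 𝔮.term_global_le_local v).mp hsum.symm w hw
    -- `a/d = a/n` with `a > 0` forces `n = d`
    have ha : 0 < (𝔮.ordq w : ℝ) * logNorm M w := by
      have h1 : (0 : ℝ) < 𝔮.ordq w := by exact_mod_cast 𝔮.ordq_pos w hw
      exact mul_pos h1 (logNorm_pos M w)
    have hn := localDegree_real_pos (M := M) w
    have hd := finrank_real_pos (M := M)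
    have : (localDegree M w : ℝ) = Module.finrank ℚ M := by
      field_simp at hterm
      nlinarith [hterm, ha, hn, hd]
    exact_mod_cast this
  · intro hall
    congr 1
    exact Finset.sum_congr rfl fun w hw => by rw [hall w hw]

end TateDivisorDatum

/-! ## 4. The corollaries for the two typed (6.11.7) carriers (E-t31's `LocusVolumeDatum`, E-t4's `AdelicLocusDatum`) -/

namespace LocusVolumeDatum

variable {M : Type*} [Field M] [NumberField M]

/-- **E-t31's READING PREDICATE `LogqDictionary` HOLDS** at every `LocusVolumeDatum d` whose `log(q)` is the genuine
`log(𝔮_M)` and whose `|log(q_ℓ)|` is the (6.11.7) sum of the GLOBALLY normalised roots `(‖q_w‖_w^{1/[M:ℚ]})^{1/2ℓ}` of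
realising elements (`ℓ = d.l`). DERIVED, not claimed. [folklore] -/
theorem logqDictionary_of_global (d : LocusVolumeDatum) (𝔮 : TateDivisorDatum M) {q : HeightOneSpectrum (𝓞 M) → M}
    (h : ∀ w ∈ 𝔮.V, ord M w (q w) = 𝔮.ordq w) (hq : d.logq = 𝔮.logq)
    (habs : d.absLogThetaQ = ∑ w ∈ 𝔮.V,
      |Real.log (((HeightOneSpectrum.adicAbv M w (q w)) ^ ((Module.finrank ℚ M : ℝ)⁻¹)) ^ ((2 * d.l : ℝ)⁻¹))|) :
    d.LogqDictionary := by
  have hl : 0 < d.l := lt_of_lt_of_le (by norm_num) d.five_le_l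
  unfold LogqDictionary
  rw [hq, habs, TateDivisorDatum.sum_abs_log_globalRoot_eq h hl]

/-- … whereas with the LOCALLY normalised roots `(‖q_w‖_w^{1/n_w})^{1/2ℓ}` one only gets `(1/2ℓ)·log(q) ≤ |log(q_ℓ)|`
(`LogqDictionary` then holds iff all `n_w = [M:ℚ]` on `V^{odd,ss}_M`). [folklore] -/
theorem logq_le_absLogThetaQ_of_local (d : LocusVolumeDatum) (𝔮 : TateDivisorDatum M) {q : HeightOneSpectrum (𝓞 M) → M}
    (h : ∀ w ∈ 𝔮.V, ord M w (q w) = 𝔮.ordq w) (hq : d.logq = 𝔮.logq)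
    (habs : d.absLogThetaQ = ∑ w ∈ 𝔮.V,
      |Real.log (((HeightOneSpectrum.adicAbv M w (q w)) ^ ((localDegree M w : ℝ)⁻¹)) ^ ((2 * d.l : ℝ)⁻¹))|) :
    1 / (2 * (d.l : ℝ)) * d.logq ≤ d.absLogThetaQ ∧
      (d.LogqDictionary ↔ ∀ w ∈ 𝔮.V, localDegree M w = Module.finrank ℚ M) := by
  have hl : 0 < d.l := lt_of_lt_of_le (by norm_num) d.five_le_l
  refine ⟨?_, ?_⟩
  · rw [hq, habs]; exact TateDivisorDatum.logq_le_sum_abs_log_localRoot h hl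
  · unfold LogqDictionary
    rw [hq, habs, eq_comm]
    exact TateDivisorDatum.sum_abs_log_localRoot_eq_iff h hl

end LocusVolumeDatum

end ATS4

namespace ATS3.AdelicLocusDatum

variable {M : Type*} [Field M] [NumberField M] {lstar : ℕ} {W : Type} [Fintype W]

/-- **E-t4's (6.11.7) sum `absLogQl` IS `(1/2ℓ)·log(𝔮)`** when the places `W` of the adelic locus datum are `V^{odd,ss}_M`
(a bijection `e`) and each `(A.loc w).qroot` is the GLOBALLY normalised root `(‖q_{e w}‖^{1/[M:ℚ]})^{1/2ℓ}` of a realising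
element. DERIVED. [folklore] -/
theorem absLogQl_eq_of_global (A : ATS3.AdelicLocusDatum lstar W) (𝔮 : ATS4.TateDivisorDatum M)
    {q : HeightOneSpectrum (𝓞 M) → M} (h : ∀ w ∈ 𝔮.V, ord M w (q w) = 𝔮.ordq w) (e : W ≃ 𝔮.V) {ℓ : ℕ} (hℓ : 0 < ℓ)
    (hroot : ∀ w : W, (A.loc w).qroot =
      ((HeightOneSpectrum.adicAbv M (e w : HeightOneSpectrum (𝓞 M)) (q (e w))) ^ ((Module.finrank ℚ M : ℝ)⁻¹)) ^
        ((2 * ℓ : ℝ)⁻¹)) :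
    A.absLogQl = 1 / (2 * ℓ) * 𝔮.logq := by
  rw [← ATS4.TateDivisorDatum.sum_abs_log_globalRoot_eq h hℓ, absLogQl, ← Finset.sum_coe_sort 𝔮.V]
  simp_rw [hroot]
  exact Fintype.sum_equiv e _ _ fun w => rfl

/-- … and with the LOCALLY normalised roots (`|q_w^{1/2ℓ}|_{C_{p_w}}`, the reading in `LocusDatum.qroot`'s docstring) one gets
`(1/2ℓ)·log(𝔮) ≤ absLogQl`, equality iff all `n_w = [M:ℚ]` on `V^{odd,ss}_M`. [folklore] -/
theorem logq_le_absLogQl_of_local (A : ATS3.AdelicLocusDatum lstar W) (𝔮 : ATS4.TateDivisorDatum M)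
    {q : HeightOneSpectrum (𝓞 M) → M} (h : ∀ w ∈ 𝔮.V, ord M w (q w) = 𝔮.ordq w) (e : W ≃ 𝔮.V) {ℓ : ℕ} (hℓ : 0 < ℓ)
    (hroot : ∀ w : W, (A.loc w).qroot =
      ((HeightOneSpectrum.adicAbv M (e w : HeightOneSpectrum (𝓞 M)) (q (e w))) ^
        ((localDegree M (e w : HeightOneSpectrum (𝓞 M)) : ℝ)⁻¹)) ^ ((2 * ℓ : ℝ)⁻¹)) :
    1 / (2 * ℓ) * 𝔮.logq ≤ A.absLogQl ∧
      (A.absLogQl = 1 / (2 * ℓ) * 𝔮.logq ↔ ∀ w ∈ 𝔮.V, localDegree M w = Module.finrank ℚ M) := by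
  have hsum : A.absLogQl = ∑ w ∈ 𝔮.V,
      |Real.log (((HeightOneSpectrum.adicAbv M w (q w)) ^ ((localDegree M w : ℝ)⁻¹)) ^ ((2 * ℓ : ℝ)⁻¹))| := by
    rw [absLogQl, ← Finset.sum_coe_sort 𝔮.V]
    simp_rw [hroot]
    exact Fintype.sum_equiv e _ _ fun w => rfl
  rw [hsum]
  exact ⟨ATS4.TateDivisorDatum.logq_le_sum_abs_log_localRoot h hℓ, ATS4.TateDivisorDatum.sum_abs_log_localRoot_eq_iff h hℓ⟩

end ATS3.AdelicLocusDatum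

/-! ## 5. (APPENDED, row 3) The Frobenius-shift identity of Thm 6.10.1 under the global dictionary

[J-IV] Thm 6.10.1, first display (p.66 l.12–20) «−|log(q^{φ(y₀)}_ℓ)| = −|log(q^{y₀}_ℓ)|», proof p.67 l.30–32 «a consequence of
the choice of the same global normalization»; Rmk 6.10.2 (p.66 l.62–65). Typed by E-t4 as `ATS4.SecondMainBoundDatum.FrobShiftEq`
(p428915; one half of the X-13 residual «FrobShiftEq ∧ HullVolShiftEq» located by E-t59, p433287) and by E-t31 as
`ATS4.LocusVolumeDatum.FrobShiftQ` (p430311). DERIVED here for every pair of (6.11.7)-sums instantiated by the GLOBAL dictionary of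
§2 from ONE `TateDivisorDatum 𝔮` of `L′` — i.e. LOCATED: what the identity needs is exactly (a) that the two arithmeticoids `y₀`,
`φ(y₀)` read the SAME orders `ord_w(q_w)` (the Tate divisor of `C/L′`, Def. 4.4.2, is intrinsic to the curve) and (b) the SAME
normalisation `÷[L′:ℚ]`; the realising ELEMENTS may differ (only their orders enter). `HullVolShiftEq` (hull VOLUMES at `y₀` vs
`φ(y₀)`) is about log-volumes, not Tate data, and stays a claim. No side taken; typed ≠ proved. -/

namespace ATS4.SecondMainBoundDatum

variable {M : Type*} [Field M] [NumberField M] {lstar : ℕ} {W : Type} [Fintype W]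

/-- **E-t4's `FrobShiftEq` DERIVED under the global dictionary**: if the (6.11.7)-sums of BOTH locus data of a
`SecondMainBoundDatum` (at `y₀` and at `φ(y₀)`) are instantiated from one `TateDivisorDatum 𝔮` — possibly through different
realising elements `q`, `q'` and different place-bijections — by the globally normalised roots, then
`−|log(q^{φ(y₀)}_ℓ)| = −|log(q^{y₀}_ℓ)|` (both sides are `(1/2ℓ)·log(𝔮)`, `absLogQl_eq_of_global`). [folklore] -/
theorem frobShiftEq_of_global (D : ATS4.SecondMainBoundDatum lstar W) (𝔮 : ATS4.TateDivisorDatum M)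
    {q q' : HeightOneSpectrum (𝓞 M) → M} (h : ∀ w ∈ 𝔮.V, ord M w (q w) = 𝔮.ordq w)
    (h' : ∀ w ∈ 𝔮.V, ord M w (q' w) = 𝔮.ordq w) (e e' : W ≃ 𝔮.V) {ℓ : ℕ} (hℓ : 0 < ℓ)
    (hstd : ∀ w : W, (D.std.loc w).qroot =
      ((HeightOneSpectrum.adicAbv M (e w : HeightOneSpectrum (𝓞 M)) (q (e w))) ^ ((Module.finrank ℚ M : ℝ)⁻¹)) ^
        ((2 * ℓ : ℝ)⁻¹))
    (hshift : ∀ w : W, (D.shift.loc w).qroot =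
      ((HeightOneSpectrum.adicAbv M (e' w : HeightOneSpectrum (𝓞 M)) (q' (e' w))) ^ ((Module.finrank ℚ M : ℝ)⁻¹)) ^
        ((2 * ℓ : ℝ)⁻¹)) :
    D.FrobShiftEq := by
  unfold FrobShiftEq
  rw [D.std.absLogQl_eq_of_global 𝔮 h e hℓ hstd, D.shift.absLogQl_eq_of_global 𝔮 h' e' hℓ hshift]

end ATS4.SecondMainBoundDatum

namespace ATS4.LocusVolumeDatum

variable {M : Type*} [Field M] [NumberField M]

/-- **E-t31's `FrobShiftQ` DERIVED under the global dictionary**: if `|log(q^{y₀}_ℓ)|` and `|log(q^{φ(y₀)}_ℓ)|` of a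
`LocusVolumeDatum` are the (6.11.7)-sums of globally normalised roots of realising elements (`q` at `y₀`, `q'` at `φ(y₀)`) of
ONE `TateDivisorDatum 𝔮`, then `−|absLogThetaQFrob| = −|absLogThetaQ|` (both are `(1/2ℓ)·log(𝔮)`). [folklore] -/
theorem frobShiftQ_of_global (d : ATS4.LocusVolumeDatum) (𝔮 : ATS4.TateDivisorDatum M)
    {q q' : HeightOneSpectrum (𝓞 M) → M} (h : ∀ w ∈ 𝔮.V, ord M w (q w) = 𝔮.ordq w)
    (h' : ∀ w ∈ 𝔮.V, ord M w (q' w) = 𝔮.ordq w)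
    (habs : d.absLogThetaQ = ∑ w ∈ 𝔮.V,
      |Real.log (((HeightOneSpectrum.adicAbv M w (q w)) ^ ((Module.finrank ℚ M : ℝ)⁻¹)) ^ ((2 * d.l : ℝ)⁻¹))|)
    (habs' : d.absLogThetaQFrob = ∑ w ∈ 𝔮.V,
      |Real.log (((HeightOneSpectrum.adicAbv M w (q' w)) ^ ((Module.finrank ℚ M : ℝ)⁻¹)) ^ ((2 * d.l : ℝ)⁻¹))|) :
    d.FrobShiftQ := by
  have hl : 0 < d.l := lt_of_lt_of_le (by norm_num) d.five_le_l
  unfold FrobShiftQ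
  rw [habs, habs', ATS4.TateDivisorDatum.sum_abs_log_globalRoot_eq h hl, ATS4.TateDivisorDatum.sum_abs_log_globalRoot_eq h' hl]

/-- Hence, at such a datum, BOTH dictionary inputs of E-t31's `thm6101_of_inputs` that concern `|log(q_ℓ)|` — `LogqDictionary`
and `FrobShiftQ` — hold (given `d.logq = log(𝔮)`). [folklore] -/
theorem logqDictionary_and_frobShiftQ_of_global (d : ATS4.LocusVolumeDatum) (𝔮 : ATS4.TateDivisorDatum M)
    {q q' : HeightOneSpectrum (𝓞 M) → M} (h : ∀ w ∈ 𝔮.V, ord M w (q w) = 𝔮.ordq w)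
    (h' : ∀ w ∈ 𝔮.V, ord M w (q' w) = 𝔮.ordq w) (hq : d.logq = 𝔮.logq)
    (habs : d.absLogThetaQ = ∑ w ∈ 𝔮.V,
      |Real.log (((HeightOneSpectrum.adicAbv M w (q w)) ^ ((Module.finrank ℚ M : ℝ)⁻¹)) ^ ((2 * d.l : ℝ)⁻¹))|)
    (habs' : d.absLogThetaQFrob = ∑ w ∈ 𝔮.V,
      |Real.log (((HeightOneSpectrum.adicAbv M w (q' w)) ^ ((Module.finrank ℚ M : ℝ)⁻¹)) ^ ((2 * d.l : ℝ)⁻¹))|) :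
    d.LogqDictionary ∧ d.FrobShiftQ :=
  ⟨d.logqDictionary_of_global 𝔮 h hq habs, d.frobShiftQ_of_global 𝔮 h h' habs habs'⟩

end ATS4.LocusVolumeDatum

end Summit.ABC.IUTFork.Joshi

end
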